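import Summits.HodgeConjecture.HodgeConjecture.Theorems.F0P6aStubE6Sockets   -- ★ PART A of the same Lines workfile (size-lint split; same namespace `Summit.HodgeConjecture.HodgeConjecture.Cruxes.HLiu418.F0P6aStubE6`)
import HarnessLib

/-!
# ★ RE-HOME — PART B (size lint: `Theorems/` files with proofs are ≤ 400 lines) of the Lines workfile whose PART A is `Theorems/F0P6aStubE6Sockets.lean`.

Same namespace `Summit.HodgeConjecture.HodgeConjecture.Cruxes.HLiu418.F0P6aStubE6` (every fully-qualified name unchanged); the preamble (options, `noncomputable section`, top-level `open`s) is
repeated verbatim from Part A; the code below is the remainder of the tree bytes, untouched.  See Part A for the ★ re-home header and the original module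
docstring.  HC_CM is proved only modulo the 7 printed citations (2 remaining: hLiu418 = stmt-HodgeConjecture-24832, h413 = stmt-HodgeConjecture-24833) until rung 0 closes.
-/


set_option autoImplicit false

noncomputable section

namespace Summit.HodgeConjecture.HodgeConjecture.Cruxes.HLiu418.F0P6aStubE6

set_option linter.dupNamespace false

open CategoryTheory CategoryTheory.Limits NumberField IsDedekindDomain MulAction Matrix AlgebraicGeometry
open scoped Matrix ComplexOrder Polynomial MonObj
open Literature.AlgebraicGeometry.Motives (SchemeOver AlgPoints ComplexPoints specOver)
open Literature.AlgebraicGeometry.Motives.AbelianVariety (bcSpec)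
open Literature.AlgebraicGeometry.Motives.GaloisDescent (gal bc gal_fst)
open Literature.AlgebraicGeometry.AbelianSchemes (PolarizedAbelianSchemeWithLevel AbelianSchemeOver)
open Literature.AlgebraicGeometry.ModuliOfAbelianVarieties
open Literature.AlgebraicGeometry.ShimuraVarieties Literature.AlgebraicGeometry.ShimuraVarieties.UnitaryCanonicalModel
open Literature.NumberTheory.Automorphic Literature.NumberTheory.Automorphic.UnitaryGroup
open Literature.NumberTheory.Automorphic.Liu2021.AppendixC (C5.OpenCompactSubgroup C5.SmallLevel)
open Literature.Geometry.Kaehler (ComplexTorus)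
open Summit.HodgeConjecture.HodgeConjecture.Cruxes.HLiu418.F0P6aPELWitnessE (GSAdele IsCMTypeThrough mOf AuxChartGS)
open Summit.HodgeConjecture.HodgeConjecture.Cruxes.HLiu418.F0P6aSigmaGAL (ReadsCGalois ReadsCReading sigmaGAL_of_stub)

/-! ## §0c THE σ1 ORGAN LAYERS (A-p06): Σ-ℂ `ReadsC` ⟹ (D2, ★ B-γ) `Reads` over `Fᵢ` ⟹ (D1, ★ B-α) `RingActionReading` -/

section Organ

variable {F : Type} [Field F] [NumberField F] [IsCMField F] {ι₁ : F →+* ℂ} {Jstar : Matrix (Fin 2) (Fin 2) F}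
  {K₀ : C5.OpenCompactSubgroup (GSAdele F Jstar)} {S : RecordSystemGS F Jstar ι₁ K₀} {Kc : C5.SmallLevel K₀}
  {Fi : Type} [Field Fi] [NumberField Fi] [Algebra F Fi] {τE : Fi →+* ℂ} {Φ : Set (F →+* ℂ)}

omit [NumberField Fi] in
/-- A complex point (along `τE`) in every connected component of the thickened record curve `X := (S.M Kc) ⊗_F Fᵢ` (finite type over
`Fᵢ`; ★ `exists_comp_eq_id_and_base_mem_connectedComponent` on `X_ℂ` and the surjection `X_ℂ → X`). [cite: GortzWedhorn2020, Prop. 3.35 and Cor. 3.36] -/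
theorem exists_complexPoint_base_mem_connectedComponent (S : RecordSystemGS F Jstar ι₁ K₀) (Kc : C5.SmallLevel K₀) (τE : Fi →+* ℂ)
    (x₀ : ↥((Literature.AlgebraicGeometry.Motives.baseChange F Fi).obj (S.M.obj Kc)).left) :
    letI : Algebra Fi ℂ := τE.toAlgebra
    ∃ x : ComplexPoints ((Literature.AlgebraicGeometry.Motives.baseChange F Fi).obj (S.M.obj Kc)),
      x.left.base (IsLocalRing.closedPoint ℂ) ∈ connectedComponent x₀ := by
  letI iFi : Algebra Fi ℂ := τE.toAlgebra
  haveI := S.smooth Kc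
  haveI : Smooth (S.M.obj Kc).hom := SmoothOfRelativeDimension.smooth 1 _
  haveI hXft : LocallyOfFiniteType ((Literature.AlgebraicGeometry.Motives.baseChange F Fi).obj (S.M.obj Kc)).hom := by
    change LocallyOfFiniteType (pullback.snd (S.M.obj Kc).hom _)
    infer_instance
  have hsurj : AlgebraicGeometry.Surjective (pullback.fst ((Literature.AlgebraicGeometry.Motives.baseChange F Fi).obj
      (S.M.obj Kc)).hom (bcSpec Fi ℂ)) := by
    haveI : Subsingleton ↥(Spec (CommRingCat.of Fi)) := inferInstanceAs (Subsingleton (PrimeSpectrum Fi))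
    haveI : AlgebraicGeometry.Surjective (bcSpec Fi ℂ) :=
      ⟨fun _ ↦ ⟨(default : ↥(Spec (CommRingCat.of ℂ))), Subsingleton.elim _ _⟩⟩
    infer_instance
  obtain ⟨y, hy⟩ := hsurj.surj x₀
  obtain ⟨t, ht₁, ht₂⟩ := Literature.AlgebraicGeometry.Morphisms.exists_comp_eq_id_and_base_mem_connectedComponent
    (pullback.snd ((Literature.AlgebraicGeometry.Motives.baseChange F Fi).obj (S.M.obj Kc)).hom (bcSpec Fi ℂ)) y
  refine ⟨AlgPoints.mk (t ≫ pullback.fst _ (bcSpec Fi ℂ)) (by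
    rw [Category.assoc, pullback.condition, ← Category.assoc, ht₁, Category.id_comp]), ?_⟩
  have hcont : Continuous (pullback.fst ((Literature.AlgebraicGeometry.Motives.baseChange F Fi).obj (S.M.obj Kc)).hom
      (bcSpec Fi ℂ)).base := Scheme.Hom.continuous _
  have hsub := ((isPreconnected_connectedComponent (x := y)).image _ hcont.continuousOn).subset_connectedComponent
    (Set.mem_image_of_mem _ (mem_connectedComponent (x := y)))
  rw [hy] at hsub
  exact hsub (Set.mem_image_of_mem _ ht₂)

omit [NumberField Fi] in
/-- The flat point (over `F`, along `ι₁ = τE ∘ (F → Fᵢ)`) under a complex point of `X` (tower adjunction ★ `exists_unique_descend_of_tower`).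
[cite: GortzWedhorn2020, Section (4.7)] -/
theorem exists_flatPoint (hτE : τE.comp (algebraMap F Fi) = ι₁) (S : RecordSystemGS F Jstar ι₁ K₀) (Kc : C5.SmallLevel K₀)
    (x : letI : Algebra Fi ℂ := τE.toAlgebra; ComplexPoints ((Literature.AlgebraicGeometry.Motives.baseChange F Fi).obj (S.M.obj Kc))) :
    ∃ Pflat : (letI : Algebra F ℂ := ι₁.toAlgebra; ComplexPoints (S.M.obj Kc)),
      Pflat.left = x.left ≫ pullback.fst (S.M.obj Kc).hom (bcSpec F Fi) := by
  letI iFi : Algebra Fi ℂ := τE.toAlgebra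
  letI iF : Algebra F ℂ := ι₁.toAlgebra
  haveI : IsScalarTower F Fi ℂ := IsScalarTower.of_algebraMap_eq' (by
    rw [RingHom.algebraMap_toAlgebra, RingHom.algebraMap_toAlgebra]
    exact hτE.symm)
  obtain ⟨Pflat, hP, -⟩ :=
    Literature.AlgebraicGeometry.Motives.exists_unique_descend_of_tower (K := F) (L := Fi) (S := ℂ) (X := S.M.obj Kc) x
  exact ⟨Pflat, hP.symm⟩

/-- **The marking datum at a complex point, from `Reads`.**  At every complex point `x` of `X` a READ family `i` supplies an additive surjective
torus marking of the fibre and the ring homomorphism `Mρ a` through which every `i b` reads (flat point ★ tower adjunction; principal representative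
★ `exists_principalRep`). [cite: Kottwitz1992, §5 (p. 390)] [cite: LangeBirkenhake1992, §1.2 Prop. 1.2.1] -/
theorem exists_markedReading_of_reads (hτE : τE.comp (algebraMap F Fi) = ι₁) (C : AuxChartGS F ι₁ Jstar K₀ S Kc Fi τE Φ)
    (ε : (Literature.AlgebraicGeometry.Motives.baseChange F Fi).obj (S.M.obj Kc) ⟶
        (Literature.AlgebraicGeometry.Motives.baseChange ℚ Fi).obj C.𝓜.M)
    (i : 𝓞 F → ((C.𝓜.univ.baseChange (ε.left ≫ pullback.fst C.𝓜.M.hom (bcSpec ℚ Fi))).A.X ⟶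
      (C.𝓜.univ.baseChange (ε.left ≫ pullback.fst C.𝓜.M.hom (bcSpec ℚ Fi))).A.X))
    (hi : ∀ b, IsMonHom (i b)) (hR : Reads C ε i hi)
    (x : letI : Algebra Fi ℂ := τE.toAlgebra; ComplexPoints ((Literature.AlgebraicGeometry.Motives.baseChange F Fi).obj (S.M.obj Kc))) :
    ∃ (Ψ : (Fin C.g ⊕ Fin C.g → ℝ) ≃L[ℝ] (Fin C.g → ℂ))
      (φ : ComplexTorus Ψ → ((C.𝓜.univ.baseChange (ε.left ≫ pullback.fst C.𝓜.M.hom (bcSpec ℚ Fi))).A.fibre x.left).toAbelianVariety.Points ℂ)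
      (M : 𝓞 F →+* Matrix (Fin C.g ⊕ Fin C.g) (Fin C.g ⊕ Fin C.g) ℤ),
      (∀ y z, φ (y + z) = φ y * φ z) ∧ Function.Surjective φ ∧
      ∀ (b : 𝓞 F) (t : ComplexTorus Ψ),
        (haveI := hi b; AlgPoints.map ((Over.pullback x.left).map (i b)) (φ t)) = φ (ComplexTorus.mapMatrix Ψ Ψ (M b) t) := by
  letI iFi : Algebra Fi ℂ := τE.toAlgebra
  -- (n3 cure, A-p04 (g23): every existential is opened with `Exists.elim` ∕ projections — `rcases` on this goal is the heartbeat hog)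
  refine (exists_flatPoint hτE S Kc x).elim fun Pflat hPflat => ?_
  refine (hR x Pflat hPflat).elim fun v h => h.elim fun hv h => h.elim fun a hva => ?_
  have hR' := hva.2
  have hN0 : C.N ≠ 0 := by have := C.hN; omega
  refine (exists_principalRep C.δ hN0 (C.piece a)).elim fun u h => h.elim fun r hur => ?_
  refine (hR' u r hur.1 hur.2.1 hur.2.2.1 hur.2.2.2.1 hur.2.2.2.2).elim fun m h => h.elim fun Θ h => h.elim fun Λ hΛ => ?_
  have hread := hΛ.2.2.2.2.2
  refine ⟨m.Ψ, m.toFun, C.Mρ a, m.toFun_add, m.isAnalytification.isHomeomorph.surjective, fun b t => ?_⟩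
  have h := hread b t
  rw [AbelianSchemeOver.fibreHom_hom_hom_hom] at h
  exact h

/-- **D1 (★ B-α).**  A READ family of homomorphisms `i : 𝒪_F → End_X(P.A)` IS a ring action: the identities `i 1 = 𝟙`, `i (ab) = i b ≫ i a`,
(E-M)∕(E-U) on a `ℤ`-basis of `𝒪_F`, hold after base change to every complex point (the marking `m` is an additive bijection onto the
fibre՚s points, `Mρ a` is a ring homomorphism, points separate endomorphisms of the fibre), hence over `X` by ★ B-α
`exists_ringAction_of_forall_exists_fieldPoint` (one complex point in every connected component of `X`: closed points have residue
fields finite over `Fᵢ ⊆ ℂ`).  [cite: Kottwitz1992, §5 (pp. 389–390)] [cite: MumfordFogartyKirwan1994, Ch. 6 §1 Corollary 6.2 (p. 116)] -/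
theorem exists_ringActionReading_of_reads (hτE : τE.comp (algebraMap F Fi) = ι₁) (C : AuxChartGS F ι₁ Jstar K₀ S Kc Fi τE Φ)
    (ε : (Literature.AlgebraicGeometry.Motives.baseChange F Fi).obj (S.M.obj Kc) ⟶
        (Literature.AlgebraicGeometry.Motives.baseChange ℚ Fi).obj C.𝓜.M)
    (i : 𝓞 F → ((C.𝓜.univ.baseChange (ε.left ≫ pullback.fst C.𝓜.M.hom (bcSpec ℚ Fi))).A.X ⟶
      (C.𝓜.univ.baseChange (ε.left ≫ pullback.fst C.𝓜.M.hom (bcSpec ℚ Fi))).A.X))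
    (hi : ∀ b, IsMonHom (i b)) (hR : Reads C ε i hi) :
    ∃ ρ : AbelianSchemeOver.RingAction (𝓞 F) (C.𝓜.univ.baseChange (ε.left ≫ pullback.fst C.𝓜.M.hom (bcSpec ℚ Fi))).A,
      RingActionReading C ε ρ := by
  classical
  letI iFi : Algebra Fi ℂ := τE.toAlgebra
  haveI hiI : ∀ b, IsMonHom (i b) := hi
  -- finiteness of the base `X := (S.M Kc) ⊗_F Fᵢ`, commutativity of `P.A`
  haveI := S.smooth Kc
  haveI : Smooth (S.M.obj Kc).hom := SmoothOfRelativeDimension.smooth 1 _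
  have hXft : LocallyOfFiniteType ((Literature.AlgebraicGeometry.Motives.baseChange F Fi).obj (S.M.obj Kc)).hom := by
    change LocallyOfFiniteType (pullback.snd (S.M.obj Kc).hom _)
    infer_instance
  haveI : IsLocallyNoetherian ((Literature.AlgebraicGeometry.Motives.baseChange F Fi).obj (S.M.obj Kc)).left :=
    LocallyOfFiniteType.isLocallyNoetherian ((Literature.AlgebraicGeometry.Motives.baseChange F Fi).obj (S.M.obj Kc)).hom
  haveI : IsCommMonObj (C.𝓜.univ.baseChange (ε.left ≫ pullback.fst C.𝓜.M.hom (bcSpec ℚ Fi))).A.X :=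
    AbelianSchemeOver.isCommMonObj_of_isLocallyNoetherian_base _
  -- one COMPLEX point in every connected component of `X`, with the READ marking there (★ generic D1)
  obtain ⟨act, hact⟩ := AbelianSchemeOver.exists_ringAction_eq_of_forall_exists_markedReading
    (A := (C.𝓜.univ.baseChange (ε.left ≫ pullback.fst C.𝓜.M.hom (bcSpec ℚ Fi))).A)
    (κ := Fin C.g ⊕ Fin C.g) (E := Fin C.g → ℂ) (i := i)
    (Module.finBasis ℤ (𝓞 F)) (fun x₀ => by
      obtain ⟨x, hxmem⟩ := exists_complexPoint_base_mem_connectedComponent (F := F) (Fi := Fi) S Kc τE x₀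
      obtain ⟨Ψ, φ, M, hφ, hsurj, hread⟩ := exists_markedReading_of_reads hτE C ε i hi hR x
      exact ⟨x.left, hxmem, Ψ, φ, M, hφ, hsurj, hread⟩)
  refine ⟨act, ?_⟩
  have hfun : act.i = i := funext hact
  change Reads C ε act.i act.isMonHom
  revert hR
  generalize hi = hi'
  revert hi'
  rw [← hfun]
  exact fun _ h => h

/-- **Σ-ℂ `ReadsC C ε Y hY`** — the ANALYTIC organ՚s output over `ℂ`: a family `Y : 𝒪_F → End_{X_ℂ}(P.A ×_X X_ℂ)` of homomorphisms
(`X_ℂ := X ⊗_{Fᵢ,τE} ℂ`) which (i) commutes with the canonical Galois automorphisms `1 ×_X gal σ`, `σ ∈ Aut(ℂ∕Fᵢ)` (E6-γ, A-p09: CM points +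
★ B-γ `forall_gal_comp_eq_of_forall_exists_fieldPoint`), and (ii) READS as `Mρ a b` at every complex point `x` of `X`: for every `ℂ`-point `q`
of the total space over the section `x̃` of `x` lying over the marked fibre point `m t`, `q ≫ Y b` lies over `m (ρ(Mρ a b) t)` (relation form, no
lifts in the statement).  Produced from P-3 ★ `siegelUniversalFamilyUniformisation` + (M-eq) + MRK-UNIQ + ★ U6-b + ★ E6-lin + E6-an (GAGA).
[cite: Lange2023AbelianVarietiesComplex, §3.4 Proposition 3.4.1] [cite: Milne2005ShimuraVarieties, §13 Prop. 13.1 p. 117] -/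
def ReadsC (C : AuxChartGS F ι₁ Jstar K₀ S Kc Fi τE Φ)
    (ε : (Literature.AlgebraicGeometry.Motives.baseChange F Fi).obj (S.M.obj Kc) ⟶
        (Literature.AlgebraicGeometry.Motives.baseChange ℚ Fi).obj C.𝓜.M)
    (Y : letI : Algebra Fi ℂ := τE.toAlgebra
      𝓞 F → (((C.𝓜.univ.baseChange (ε.left ≫ pullback.fst C.𝓜.M.hom (bcSpec ℚ Fi))).A.baseChange
        (pullback.fst ((Literature.AlgebraicGeometry.Motives.baseChange F Fi).obj (S.M.obj Kc)).hom (bcSpec Fi ℂ))).X ⟶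
        ((C.𝓜.univ.baseChange (ε.left ≫ pullback.fst C.𝓜.M.hom (bcSpec ℚ Fi))).A.baseChange
        (pullback.fst ((Literature.AlgebraicGeometry.Motives.baseChange F Fi).obj (S.M.obj Kc)).hom (bcSpec Fi ℂ))).X))
    (_hY : letI : Algebra Fi ℂ := τE.toAlgebra; ∀ b, IsMonHom (Y b)) : Prop :=
  letI P := C.𝓜.univ.baseChange (ε.left ≫ pullback.fst C.𝓜.M.hom (bcSpec ℚ Fi))
  letI X := (Literature.AlgebraicGeometry.Motives.baseChange F Fi).obj (S.M.obj Kc)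
  letI : Algebra Fi ℂ := τE.toAlgebra
  letI prX := pullback.fst X.hom (bcSpec Fi ℂ)
  -- (i) GALOIS EQUIVARIANCE for the canonical `1 ×_X gal σ`
  (∀ (b : 𝓞 F) (σ : ℂ ≃ₐ[Fi] ℂ),
    pullback.map P.A.X.hom prX P.A.X.hom prX (𝟙 P.A.X.left) (gal ℂ X σ) (𝟙 X.left)
        (by rw [Category.comp_id, Category.id_comp]) (by rw [Category.comp_id, gal_fst]) ≫ (Y b).left =
      (Y b).left ≫ pullback.map P.A.X.hom prX P.A.X.hom prX (𝟙 P.A.X.left) (gal ℂ X σ) (𝟙 X.left)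
        (by rw [Category.comp_id, Category.id_comp]) (by rw [Category.comp_id, gal_fst])) ∧
  -- (ii) THE READING at complex points of `X`, in the total space `P.A ×_X X_ℂ`
  ∀ (x : ComplexPoints X) (Pflat : letI : Algebra F ℂ := ι₁.toAlgebra; ComplexPoints (S.M.obj Kc)),
    Pflat.left = x.left ≫ pullback.fst (S.M.obj Kc).hom (bcSpec F Fi) →
    ∃ (v : Fin 2 → ℂ) (hv : v ∈ negCone (Jstar.map ι₁)) (a : GSAdele F Jstar),
      (letI : Algebra F ℂ := ι₁.toAlgebra; S.pts Kc Pflat) = ShimuraSetGS.mk F Jstar ι₁ Kc.1.1 v hv a ∧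
      ∀ (u : finAdeleQˣ) (r : gspFinAdelic C.δ),
        (∀ w, Valued.v ((u : finAdeleQ) w) = 1) →
        (u : finAdeleQ) - ((C.piece a : ZMod C.N).val : ℕ) ∈ levelIdeal C.N →
        r ∈ principalLevelSubgroup C.δ 1 →
        IsMultiplier (typeFormOver C.δ finAdeleQ) (r : GL (Fin C.g ⊕ Fin C.g) finAdeleQ) u →
        ((r : GL (Fin C.g ⊕ Fin C.g) finAdeleQ) : Matrix (Fin C.g ⊕ Fin C.g) (Fin C.g ⊕ Fin C.g) finAdeleQ) =
          Matrix.fromBlocks 1 0 0 ((u : finAdeleQ) • (1 : Matrix (Fin C.g) (Fin C.g) finAdeleQ)) →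
        ∃ (m : SiegelAdelicMarking ⟨SiegelModuli.jOfSiegel C.δ (C.Z a v),
              SiegelComplexRecordSystem.jOfSiegel_mem_C0pm C.hδ.1 (C.Z_mem a v hv)⟩ r (P.A.fibre x.left).toAbelianVariety)
          (Θ : Literature.AlgebraicGeometry.Motives.CartierDivisor (P.A.fibre x.left).toAbelianVariety.X.left)
          (Λ : P.level.SymplecticLift x.left Θ C.δ),
          Θ.IsAmple ∧ P.A.IsLambdaOfAt x.left P.D P.pol.lam Θ ∧
          (∀ ⦃M : ℕ⦄, C.N ∣ M → M ≠ 0 → ∀ (y : Fin C.g ⊕ Fin C.g → ZMod M) (w : Fin C.g ⊕ Fin C.g → ℚ),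
            AdelicCongr ((r⁻¹ : gspFinAdelic C.δ) : GL (Fin C.g ⊕ Fin C.g) finAdeleQ) 1 w (fun i => ((y i).val : ℚ) / M) →
              ((Λ.lift M (Multiplicative.ofAdd y)) : (P.A.fibre x.left).toAbelianVariety.Points ℂ) = m.r w) ∧
          m.γ = 1 ∧ (∀ w : Fin C.g ⊕ Fin C.g → ℝ, m.Ψ w = siegelPeriodMap C.δ (C.Z a v) w) ∧
          ∀ (b : 𝓞 F) (t : ComplexTorus m.Ψ) (q : Spec (.of ℂ) ⟶ pullback P.A.X.hom prX),
            q ≫ pullback.fst P.A.X.hom prX = P.A.fibrePointToLeft x.left (m.toFun t) →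
            q ≫ pullback.snd P.A.X.hom prX ≫ pullback.snd X.hom (bcSpec Fi ℂ) = 𝟙 _ →
            (q ≫ (Y b).left) ≫ pullback.fst P.A.X.hom prX =
              P.A.fibrePointToLeft x.left (m.toFun (ComplexTorus.mapMatrix m.Ψ m.Ψ (C.Mρ a b) t))


/-- `ReadsC` is literally the conjunction of its two clauses (Σ-GAL ∧ Σ-AN). [cite: Lange2023AbelianVarietiesComplex, §3.4 Proposition 3.4.1] -/
theorem readsC_of_galois_of_reading (C : AuxChartGS F ι₁ Jstar K₀ S Kc Fi τE Φ)
    (ε : (Literature.AlgebraicGeometry.Motives.baseChange F Fi).obj (S.M.obj Kc) ⟶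
        (Literature.AlgebraicGeometry.Motives.baseChange ℚ Fi).obj C.𝓜.M)
    (Y : letI : Algebra Fi ℂ := τE.toAlgebra
      𝓞 F → (((C.𝓜.univ.baseChange (ε.left ≫ pullback.fst C.𝓜.M.hom (bcSpec ℚ Fi))).A.baseChange
        (pullback.fst ((Literature.AlgebraicGeometry.Motives.baseChange F Fi).obj (S.M.obj Kc)).hom (bcSpec Fi ℂ))).X ⟶
        ((C.𝓜.univ.baseChange (ε.left ≫ pullback.fst C.𝓜.M.hom (bcSpec ℚ Fi))).A.baseChange
        (pullback.fst ((Literature.AlgebraicGeometry.Motives.baseChange F Fi).obj (S.M.obj Kc)).hom (bcSpec Fi ℂ))).X))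
    (hY : letI : Algebra Fi ℂ := τE.toAlgebra; ∀ b, IsMonHom (Y b)) (hG : ReadsCGalois C ε Y hY) (hR : ReadsCReading C ε Y hY) :
    ReadsC C ε Y hY :=
  ⟨hG, hR⟩

/-- **D2♭ — the READING of a descended member at one complex point** (★ `algPointsMap_fibreHom_eq_of_forall_lift` applied inside the (ADM)
block: the `Reads`-clause at `x` for `e` from the `ReadsC`-clause at `x` for `Y = e ×_X X_ℂ`). [cite: MumfordFogartyKirwan1994, Ch. 6 §2 Definition 6.3 (p. 120)] -/
theorem reads_clause_of_readsC_clause (C : AuxChartGS F ι₁ Jstar K₀ S Kc Fi τE Φ)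
    (ε : (Literature.AlgebraicGeometry.Motives.baseChange F Fi).obj (S.M.obj Kc) ⟶
        (Literature.AlgebraicGeometry.Motives.baseChange ℚ Fi).obj C.𝓜.M)
    (Y : letI : Algebra Fi ℂ := τE.toAlgebra
      𝓞 F → (((C.𝓜.univ.baseChange (ε.left ≫ pullback.fst C.𝓜.M.hom (bcSpec ℚ Fi))).A.baseChange
        (pullback.fst ((Literature.AlgebraicGeometry.Motives.baseChange F Fi).obj (S.M.obj Kc)).hom (bcSpec Fi ℂ))).X ⟶
        ((C.𝓜.univ.baseChange (ε.left ≫ pullback.fst C.𝓜.M.hom (bcSpec ℚ Fi))).A.baseChange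
        (pullback.fst ((Literature.AlgebraicGeometry.Motives.baseChange F Fi).obj (S.M.obj Kc)).hom (bcSpec Fi ℂ))).X))
    (e : 𝓞 F → ((C.𝓜.univ.baseChange (ε.left ≫ pullback.fst C.𝓜.M.hom (bcSpec ℚ Fi))).A.X ⟶
      (C.𝓜.univ.baseChange (ε.left ≫ pullback.fst C.𝓜.M.hom (bcSpec ℚ Fi))).A.X)) (he : ∀ b, IsMonHom (e b))
    (hpb : letI : Algebra Fi ℂ := τE.toAlgebra
      ∀ b, (Over.pullback (pullback.fst ((Literature.AlgebraicGeometry.Motives.baseChange F Fi).obj (S.M.obj Kc)).hom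
        (bcSpec Fi ℂ))).map (e b) = Y b)
    (x : letI : Algebra Fi ℂ := τE.toAlgebra; ComplexPoints ((Literature.AlgebraicGeometry.Motives.baseChange F Fi).obj (S.M.obj Kc)))
    (v : Fin 2 → ℂ) (hv : v ∈ negCone (Jstar.map ι₁)) (a : GSAdele F Jstar) (r : gspFinAdelic C.δ)
    (m : SiegelAdelicMarking ⟨SiegelModuli.jOfSiegel C.δ (C.Z a v), SiegelComplexRecordSystem.jOfSiegel_mem_C0pm C.hδ.1 (C.Z_mem a v hv)⟩ r
      ((C.𝓜.univ.baseChange (ε.left ≫ pullback.fst C.𝓜.M.hom (bcSpec ℚ Fi))).A.fibre x.left).toAbelianVariety)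
    (hreadC : letI : Algebra Fi ℂ := τE.toAlgebra
      letI P := C.𝓜.univ.baseChange (ε.left ≫ pullback.fst C.𝓜.M.hom (bcSpec ℚ Fi))
      letI X := (Literature.AlgebraicGeometry.Motives.baseChange F Fi).obj (S.M.obj Kc)
      ∀ (b : 𝓞 F) (t : ComplexTorus m.Ψ) (q : Spec (.of ℂ) ⟶ pullback P.A.X.hom (pullback.fst X.hom (bcSpec Fi ℂ))),
        q ≫ pullback.fst P.A.X.hom (pullback.fst X.hom (bcSpec Fi ℂ)) = P.A.fibrePointToLeft x.left (m.toFun t) →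
        q ≫ pullback.snd P.A.X.hom (pullback.fst X.hom (bcSpec Fi ℂ)) ≫ pullback.snd X.hom (bcSpec Fi ℂ) = 𝟙 _ →
        (q ≫ (Y b).left) ≫ pullback.fst P.A.X.hom (pullback.fst X.hom (bcSpec Fi ℂ)) =
          P.A.fibrePointToLeft x.left (m.toFun (ComplexTorus.mapMatrix m.Ψ m.Ψ (C.Mρ a b) t)))
    (b : 𝓞 F) (t : ComplexTorus m.Ψ) :
    haveI := he b
    AlgPoints.map (AbelianSchemeOver.fibreHom (e b) x.left).hom.hom.hom (m.toFun t) =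
      m.toFun (ComplexTorus.mapMatrix m.Ψ m.Ψ (C.Mρ a b) t) := by
  letI iFi : Algebra Fi ℂ := τE.toAlgebra
  haveI := he b
  exact AbelianSchemeOver.algPointsMap_fibreHom_eq_of_forall_lift _ (e b) (Y b) (hpb b) x (m.toFun t)
    (m.toFun (ComplexTorus.mapMatrix m.Ψ m.Ψ (C.Mρ a b) t)) (fun q hq₁ hq₂ => hreadC b t q hq₁ hq₂)

/-- **D2 (★ B-γ).**  A Galois-equivariant READ family over `X_ℂ` descends to a READ family over `X` (over `Fᵢ`): ★ B-γ
`existsUnique_pullback_map_eq_of_forall_gal_comp` (`#Fᵢ ≤ ℵ₀`; `X` separated, locally Noetherian; `P.A ×_X X_ℂ` reduced) gives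
`e b` with `e b ×_X X_ℂ = Y b`, a homomorphism by ★ `isMonHom_of_pullback_map_eq_bcSpec`; the reading of `e b` at `x` is the reading of
`Y b` at the section `x̃` projected by `pr₁` (★ `fibrePointToLeft_map_fibreHom`, `fibrePointToLeft_injective`).
[cite: Milne2005ShimuraVarieties, §13 Prop. 13.1 p. 117] [cite: MumfordFogartyKirwan1994, Ch. 6 §1 Corollary 6.2 (p. 116)] -/
theorem exists_reads_of_readsC (_hτE : τE.comp (algebraMap F Fi) = ι₁) (C : AuxChartGS F ι₁ Jstar K₀ S Kc Fi τE Φ)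
    (ε : (Literature.AlgebraicGeometry.Motives.baseChange F Fi).obj (S.M.obj Kc) ⟶
        (Literature.AlgebraicGeometry.Motives.baseChange ℚ Fi).obj C.𝓜.M)
    (Y : letI : Algebra Fi ℂ := τE.toAlgebra
      𝓞 F → (((C.𝓜.univ.baseChange (ε.left ≫ pullback.fst C.𝓜.M.hom (bcSpec ℚ Fi))).A.baseChange
        (pullback.fst ((Literature.AlgebraicGeometry.Motives.baseChange F Fi).obj (S.M.obj Kc)).hom (bcSpec Fi ℂ))).X ⟶
        ((C.𝓜.univ.baseChange (ε.left ≫ pullback.fst C.𝓜.M.hom (bcSpec ℚ Fi))).A.baseChange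
        (pullback.fst ((Literature.AlgebraicGeometry.Motives.baseChange F Fi).obj (S.M.obj Kc)).hom (bcSpec Fi ℂ))).X))
    (hY : letI : Algebra Fi ℂ := τE.toAlgebra; ∀ b, IsMonHom (Y b)) (hC : ReadsC C ε Y hY) :
    ∃ (i : 𝓞 F → ((C.𝓜.univ.baseChange (ε.left ≫ pullback.fst C.𝓜.M.hom (bcSpec ℚ Fi))).A.X ⟶
      (C.𝓜.univ.baseChange (ε.left ≫ pullback.fst C.𝓜.M.hom (bcSpec ℚ Fi))).A.X)) (hi : ∀ b, IsMonHom (i b)),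
      Reads C ε i hi := by
  classical
  letI iFi : Algebra Fi ℂ := τE.toAlgebra
  -- hypotheses of ★ B-γ: `X` separated ∕ locally Noetherian, `X_ℂ` locally Noetherian, `P.A ×_X X_ℂ` reduced, `#Fᵢ ≤ ℵ₀`
  haveI := S.smooth Kc
  haveI : Smooth (S.M.obj Kc).hom := SmoothOfRelativeDimension.smooth 1 _
  haveI : IsProper (S.M.obj Kc).hom := Literature.AlgebraicGeometry.Motives.IsProjectiveOver.isProper (S.projective Kc)
  haveI : IsSeparated ((Literature.AlgebraicGeometry.Motives.baseChange F Fi).obj (S.M.obj Kc)).hom := by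
    change IsSeparated (pullback.snd (S.M.obj Kc).hom _)
    infer_instance
  haveI hXsm : Smooth ((Literature.AlgebraicGeometry.Motives.baseChange F Fi).obj (S.M.obj Kc)).hom := by
    change Smooth (pullback.snd (S.M.obj Kc).hom _)
    infer_instance
  haveI : IsLocallyNoetherian ((Literature.AlgebraicGeometry.Motives.baseChange F Fi).obj (S.M.obj Kc)).left :=
    LocallyOfFiniteType.isLocallyNoetherian ((Literature.AlgebraicGeometry.Motives.baseChange F Fi).obj (S.M.obj Kc)).hom
  haveI : IsLocallyNoetherian (bc ℂ ((Literature.AlgebraicGeometry.Motives.baseChange F Fi).obj (S.M.obj Kc))) :=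
    LocallyOfFiniteType.isLocallyNoetherian
      (pullback.snd ((Literature.AlgebraicGeometry.Motives.baseChange F Fi).obj (S.M.obj Kc)).hom (bcSpec Fi ℂ))
  haveI := (C.𝓜.univ.baseChange (ε.left ≫ pullback.fst C.𝓜.M.hom (bcSpec ℚ Fi))).A.isSmooth
  haveI : IsReduced (pullback (C.𝓜.univ.baseChange (ε.left ≫ pullback.fst C.𝓜.M.hom (bcSpec ℚ Fi))).A.X.hom
      (pullback.fst ((Literature.AlgebraicGeometry.Motives.baseChange F Fi).obj (S.M.obj Kc)).hom (bcSpec Fi ℂ))) :=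
    Literature.AlgebraicGeometry.Motives.isReduced_of_smooth_over_field
      (pullback.snd (C.𝓜.univ.baseChange (ε.left ≫ pullback.fst C.𝓜.M.hom (bcSpec ℚ Fi))).A.X.hom
          (pullback.fst ((Literature.AlgebraicGeometry.Motives.baseChange F Fi).obj (S.M.obj Kc)).hom (bcSpec Fi ℂ)) ≫
        pullback.snd ((Literature.AlgebraicGeometry.Motives.baseChange F Fi).obj (S.M.obj Kc)).hom (bcSpec Fi ℂ))
  have hK : Cardinal.mk Fi ≤ Cardinal.aleph0 :=
    (Algebra.IsAlgebraic.cardinalMk_le_max ℚ Fi).trans (by rw [Cardinal.mkRat, max_self])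
  haveI := hY
  -- (n3 cure, A-p04 (g23): every existential is opened with `Exists.elim` ∕ projections — `rcases` on this goal is the heartbeat hog)
  have hgal := hC.1
  have hread := hC.2
  -- §1 descent of the family (★ `exists_family_pullback_map_eq_of_forall_gal_comp`)
  refine (AbelianSchemeOver.exists_family_pullback_map_eq_of_forall_gal_comp
    (C.𝓜.univ.baseChange (ε.left ≫ pullback.fst C.𝓜.M.hom (bcSpec ℚ Fi))).A hK Y hgal).elim fun e h => ?_
  have he := h.1
  have hpb := h.2
  refine ⟨e, he, ?_⟩
  -- §2 the readings descend (★ `algPointsMap_fibreHom_eq_of_forall_lift`)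
  intro x Pflat hPflat
  refine (hread x Pflat hPflat).elim fun v h => h.elim fun hv h => h.elim fun a hva => ?_
  refine ⟨v, hv, a, hva.1, fun u r hu₁ hu₂ hr₁ hr₂ hr₃ => ?_⟩
  exact (hva.2 u r hu₁ hu₂ hr₁ hr₂ hr₃).elim fun m h => h.elim fun Θ h => h.elim fun Λ hΛ =>
    ⟨m, Θ, Λ, hΛ.1, hΛ.2.1, hΛ.2.2.1, hΛ.2.2.2.1, hΛ.2.2.2.2.1, fun b t =>
      reads_clause_of_readsC_clause C ε Y e he hpb x v hv a r m hΛ.2.2.2.2.2 b t⟩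

end Organ


/-! (★ re-home, size lint: this is PART A of `Lines/…` — the file continues, in the same namespace, in `Theorems/F0P6aStubE6.lean`.) -/

end Summit.HodgeConjecture.HodgeConjecture.Cruxes.HLiu418.F0P6aStubE6

end
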